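import Summits.Parity.BatemanHorn.Theorems.SoloInformedPairWindowInner

/-!
# Balanced pair window, generic weights — II: the main term (soloist file, project (F)-kernel, L2b)

Soloist file (informed mode).  The double sum of the main term of the balanced divisor window for a
pair of linear congruences, for a window weight `G(d) = [window] u₀(d₀) · μ(d₁)(α_{d₀} + β_{d₀} log d₁
+ γ_{d₀} log² d₁)` with `|u₀| ≤ G₀` and `|α|, |β|, |γ| ≤ Λ` (generalising
`LinearPairMoebius.abs_doubleSum_le`, weight `μ log ⊗ μ log`):
`|Σ_{d₀ ≤ B₀} Σ_{d₁ ≤ B₁} (u₀(d₀)/d₀) [gcd(d₀,q₀)=1] [window] T(d₀,d₁)|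
   ≤ G₀ K (2 + 2 log x) 3⁴ (2/σ)⁸ (log x)^{-4}`, `K = τ(D)(1 + log D)²(C₀+C₁+C₂) Λ 4^{ω(q₁)}`
(`abs_doubleSum_le_quad`), and the conversion of `[Sol(d)] G(d)/lcm(d₀,d₁)` into that summand
(`mainTerm_summand_eq_gen`).  With `u₀ = μ`, `α = log² d₀`, `β = 2 log d₀`, `γ = 1` this is the main
term for the twin weight `μ(d₀)μ(d₁) log²(d₀d₁)`. [folklore]
-/

namespace Summit.Parity.BatemanHorn.Theorems.PairWindow

open Finset Real
open scoped ArithmeticFunction.Moebius ArithmeticFunction.omega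
open Literature.NumberTheory.Sieve

/-! ### The main-term summand -/

/-- For a window weight `G = [window] u₀(d₀) v(d₀,d₁)` and `dᵢ ≥ 1`:
`[Sol(d)] G(d)/lcm(d₀,d₁) = (u₀(d₀)/d₀) [gcd(d₀,q₀)=1] [window] [gcd(d₁,q₁)=1 ∧ gcd(d₀,d₁) ∣ Δ]
v(d₀,d₁) gcd(d₀,d₁)/d₁` (`1/lcm = gcd/(d₀d₁)`). [folklore] -/
theorem mainTerm_summand_eq_gen {q₀ q₁ : ℕ} (Δ : ℤ) (σ θ η X : ℝ) (u₀ : ℕ → ℝ) (v : ℕ → ℕ → ℝ)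
    {d₀ d₁ : ℕ} (hd₀ : 0 < d₀) (hd₁ : 0 < d₁) :
    (if (Nat.Coprime d₀ q₀ ∧ Nat.Coprime d₁ q₁ ∧ ((Nat.gcd d₀ d₁ : ℕ) : ℤ) ∣ Δ) then
        (if (X ^ (1 - η) < (d₀ : ℝ) * d₁ ∧ (d₀ : ℝ) * d₁ ≤ X ^ (1 + θ) ∧
            X ^ σ < (d₀ : ℝ) ∧ X ^ σ < (d₁ : ℝ)) then u₀ d₀ * v d₀ d₁ else 0) else 0) /
        (Nat.lcm d₀ d₁ : ℕ) =
      u₀ d₀ / d₀ * ((if Nat.Coprime d₀ q₀ then (1 : ℝ) else 0) *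
        (if (X ^ (1 - η) < (d₀ : ℝ) * d₁ ∧ (d₀ : ℝ) * d₁ ≤ X ^ (1 + θ) ∧
            X ^ σ < (d₀ : ℝ) ∧ X ^ σ < (d₁ : ℝ)) then
          (if Nat.Coprime d₁ q₁ ∧ ((Nat.gcd d₀ d₁ : ℕ) : ℤ) ∣ Δ then
            v d₀ d₁ * ((Nat.gcd d₀ d₁ : ℝ) / d₁) else 0) else 0)) := by
  have hL : ((Nat.lcm d₀ d₁ : ℕ) : ℝ) = (d₀ : ℝ) * d₁ / (Nat.gcd d₀ d₁ : ℕ) := by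
    have h := Nat.gcd_mul_lcm d₀ d₁
    have hg : (0 : ℝ) < (Nat.gcd d₀ d₁ : ℕ) := by exact_mod_cast Nat.gcd_pos_of_pos_left _ hd₀
    rw [eq_div_iff hg.ne']
    have : ((Nat.gcd d₀ d₁ * Nat.lcm d₀ d₁ : ℕ) : ℝ) = ((d₀ * d₁ : ℕ) : ℝ) := by rw [h]
    push_cast at this
    linarith
  have hd₀R : (0 : ℝ) < d₀ := by exact_mod_cast hd₀
  have hd₁R : (0 : ℝ) < d₁ := by exact_mod_cast hd₁
  have hg0 : (0 : ℝ) < (Nat.gcd d₀ d₁ : ℕ) := by exact_mod_cast Nat.gcd_pos_of_pos_left _ hd₀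
  rw [hL]
  by_cases hw : (X ^ (1 - η) < (d₀ : ℝ) * d₁ ∧ (d₀ : ℝ) * d₁ ≤ X ^ (1 + θ) ∧
      X ^ σ < (d₀ : ℝ) ∧ X ^ σ < (d₁ : ℝ))
  · simp only [if_pos hw]
    by_cases h0 : Nat.Coprime d₀ q₀
    · by_cases h1 : Nat.Coprime d₁ q₁ ∧ ((Nat.gcd d₀ d₁ : ℕ) : ℤ) ∣ Δ
      · rw [if_pos ⟨h0, h1⟩, if_pos h0, if_pos h1]
        field_simp
      · rw [if_neg (fun h => h1 h.2), if_pos h0, if_neg h1]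
        simp
    · rw [if_neg (fun h => h0 h.1), if_neg h0]
      simp
  · simp only [if_neg hw]
    split_ifs <;> simp

/-! ### The double sum over `(d₀, d₁)` is `≪ G₀ Λ (log x)^3 / (log x)^4` -/

/-- **The double sum of the main term, quadratic-in-log inner weights.**  For `q₁ ≥ 1`, `Δ ≠ 0`,
`D = |Δ|`, Siegel–Walfisz-strength constants `C₀, C₁, C₂` (tails of `Σ_{(m,q)=1} μ(m)/m`,
`Σ μ(m) log m/m`, `Σ μ(m) log² m/m`, exponent `8`), coefficient functions `α, β, γ` of `d₀` bounded by
`Λ ≥ 0` on `[1, B₀]`, an outer weight `|u₀(d₀)| ≤ G₀` on `[1, B₀]`, `σ > 0`, real `θ, η`, a natural `x ≥ 3` with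
`2D ≤ x^σ`, `D ≤ x^{σ/2}`, and box sides `B₀, B₁ ≤ x²`:
`|Σ_{d₀ ≤ B₀} Σ_{d₁ ≤ B₁} (u₀(d₀)/d₀) [gcd(d₀,q₀)=1] [window] T(d₀,d₁)|
  ≤ G₀ K (2 + 2 log x) 3⁴ (2/σ)⁸ / (log x)⁴`,
`T = [gcd(d₁,q₁)=1][gcd(d₀,d₁) ∣ Δ] μ(d₁)(α + β log d₁ + γ log² d₁) gcd(d₀,d₁)/d₁`,
`K = τ(D)(1 + log D)²(C₀ + C₁ + C₂) Λ 4^{ω(q₁)}`. [folklore] -/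
theorem abs_doubleSum_le_quad (q₀ : ℕ) {q₁ : ℕ} (hq₁ : 0 < q₁) {Δ : ℤ} (hΔ : Δ ≠ 0)
    {C₀ C₁ C₂ : ℝ} (hC₀0 : 0 ≤ C₀) (hC₁0 : 0 ≤ C₁) (hC₂0 : 0 ≤ C₂)
    (hC₀ : ∀ q : ℕ, q ≠ 0 → ∀ A W : ℝ, 2 ≤ A → A ≤ W →
      |∑ n ∈ (Ioc ⌊A⌋₊ ⌊W⌋₊).filter (fun n : ℕ => n.Coprime q), (μ n : ℝ) / n| ≤
        C₀ * (4 : ℝ) ^ q.primeFactors.card / Real.log A ^ (8 : ℝ))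
    (hC₁ : ∀ q : ℕ, q ≠ 0 → ∀ A W : ℝ, 2 ≤ A → A ≤ W →
      |∑ n ∈ (Ioc ⌊A⌋₊ ⌊W⌋₊).filter (fun n : ℕ => n.Coprime q), (μ n : ℝ) * Real.log n / n| ≤
        C₁ * (4 : ℝ) ^ q.primeFactors.card / Real.log A ^ (8 : ℝ))
    (hC₂ : ∀ q : ℕ, q ≠ 0 → ∀ A W : ℝ, 2 ≤ A → A ≤ W →
      |∑ n ∈ (Ioc ⌊A⌋₊ ⌊W⌋₊).filter (fun n : ℕ => n.Coprime q),
          (μ n : ℝ) * Real.log n ^ 2 / n| ≤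
        C₂ * (4 : ℝ) ^ q.primeFactors.card * (2 + Real.log W) / Real.log A ^ (8 : ℝ))
    {u₀ : ℕ → ℝ} {G₀ : ℝ} (hG₀ : 0 ≤ G₀) {B₀ : ℕ} (hu₀ : ∀ d, 1 ≤ d → d ≤ B₀ → |u₀ d| ≤ G₀)
    {α β γ : ℕ → ℝ} {Λ : ℝ} (hΛ : 0 ≤ Λ) (hα : ∀ d, 1 ≤ d → d ≤ B₀ → |α d| ≤ Λ)
    (hβ : ∀ d, 1 ≤ d → d ≤ B₀ → |β d| ≤ Λ) (hγ : ∀ d, 1 ≤ d → d ≤ B₀ → |γ d| ≤ Λ)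
    {σ : ℝ} (hσ : 0 < σ) (θ η : ℝ) {x : ℕ} (hx₃ : 3 ≤ x)
    (hx₁ : 2 * (Δ.natAbs : ℝ) ≤ (x : ℝ) ^ σ) (hx₂ : (Δ.natAbs : ℝ) ≤ (x : ℝ) ^ (σ / 2))
    (hB0 : (B₀ : ℝ) ≤ (x : ℝ) ^ 2) {B₁ : ℕ} (hB1 : (B₁ : ℝ) ≤ (x : ℝ) ^ 2) :
    |∑ d₀ ∈ Finset.Icc 1 B₀, ∑ d₁ ∈ Finset.Icc 1 B₁,
        u₀ d₀ / d₀ * ((if Nat.Coprime d₀ q₀ then (1 : ℝ) else 0) *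
          (if (x : ℝ) ^ (1 - η) < (d₀ : ℝ) * d₁ ∧ (d₀ : ℝ) * d₁ ≤ (x : ℝ) ^ (1 + θ) ∧
              (x : ℝ) ^ σ < (d₀ : ℝ) ∧ (x : ℝ) ^ σ < (d₁ : ℝ) then
            (if Nat.Coprime d₁ q₁ ∧ ((Nat.gcd d₀ d₁ : ℕ) : ℤ) ∣ Δ then
              (μ d₁ : ℝ) * (α d₀ + β d₀ * Real.log d₁ + γ d₀ * Real.log d₁ ^ 2) *
                ((Nat.gcd d₀ d₁ : ℝ) / d₁) else 0) else 0))| ≤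
      G₀ * ((Δ.natAbs.divisors.card : ℝ) * (1 + Real.log Δ.natAbs) ^ 2 * (C₀ + C₁ + C₂) * Λ *
        (4 : ℝ) ^ q₁.primeFactors.card) * (2 + 2 * Real.log x) * 3 ^ 4 * (2 / σ) ^ (8 : ℝ) /
          Real.log x ^ 4 := by
  set D : ℕ := Δ.natAbs with hDdef
  have hD : 0 < D := Int.natAbs_pos.2 hΔ
  have hDpos : (0 : ℝ) < D := by exact_mod_cast hD
  have hD1 : (1 : ℝ) ≤ D := by exact_mod_cast hD
  have hΛ0 : 0 ≤ Λ := hΛ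
  set K : ℝ := (D.divisors.card : ℝ) * (1 + Real.log D) ^ 2 * (C₀ + C₁ + C₂) * Λ *
    (4 : ℝ) ^ q₁.primeFactors.card with hKdef
  have hK0 : 0 ≤ K := by
    rw [hKdef]
    have : 0 ≤ Real.log D := Real.log_nonneg hD1
    positivity
  have hx3 : (3 : ℝ) ≤ x := by exact_mod_cast hx₃
  have hx0 : (0 : ℝ) < x := by linarith
  have hlogx : 1 < Real.log x := by
    have := Real.exp_one_lt_d9
    rw [Real.lt_log_iff_exp_lt hx0]; linarith
  have hxσ : 0 ≤ (x : ℝ) ^ σ := Real.rpow_nonneg hx0.le σ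
  have hx1θ : 0 ≤ (x : ℝ) ^ (1 + θ) := Real.rpow_nonneg hx0.le _
  have hlogx2 : Real.log ((x : ℝ) ^ 2) = 2 * Real.log x := by
    rw [show (x : ℝ) ^ 2 = (x : ℝ) ^ (2 : ℝ) by norm_cast, Real.log_rpow hx0]
  have hlogB1 : Real.log B₁ ≤ 2 * Real.log x := by
    rcases Nat.eq_zero_or_pos B₁ with h0 | hpos
    · rw [h0, Nat.cast_zero, Real.log_zero]; positivity
    · rw [← hlogx2]; exact Real.log_le_log (by exact_mod_cast hpos) hB1
  -- Step 2: for each `d₀`, the `d₁`-sum is an inner sum over an interval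
  have hinner : ∀ d₀ ∈ Finset.Icc 1 B₀,
      |∑ d₁ ∈ Finset.Icc 1 B₁, u₀ d₀ / d₀ *
        ((if Nat.Coprime d₀ q₀ then (1 : ℝ) else 0) *
          (if (x : ℝ) ^ (1 - η) < (d₀ : ℝ) * d₁ ∧ (d₀ : ℝ) * d₁ ≤ (x : ℝ) ^ (1 + θ) ∧
              (x : ℝ) ^ σ < (d₀ : ℝ) ∧ (x : ℝ) ^ σ < (d₁ : ℝ) then
            (if Nat.Coprime d₁ q₁ ∧ ((Nat.gcd d₀ d₁ : ℕ) : ℤ) ∣ Δ then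
              (μ d₁ : ℝ) * (α d₀ + β d₀ * Real.log d₁ + γ d₀ * Real.log d₁ ^ 2) *
                ((Nat.gcd d₀ d₁ : ℝ) / d₁) else 0) else 0))| ≤
          G₀ / d₀ * (K * (2 + 2 * Real.log x) * (4 : ℝ) ^ d₀.primeFactors.card /
            ((σ / 2) * Real.log x) ^ (8 : ℝ)) := by
    intro d₀ hd₀
    rw [Finset.mem_Icc] at hd₀
    have hd₀pos : 0 < d₀ := hd₀.1
    have hd₀R : (0 : ℝ) < d₀ := by exact_mod_cast hd₀pos
    rw [← Finset.mul_sum, ← Finset.mul_sum, abs_mul, abs_mul]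
    -- `|u₀(d₀)/d₀| ≤ G₀/d₀`
    have hw : |u₀ d₀ / d₀| ≤ G₀ / d₀ := by
      rw [abs_div, abs_of_pos hd₀R]
      exact div_le_div_of_nonneg_right (hu₀ d₀ hd₀.1 hd₀.2) hd₀R.le
    have hind : |(if Nat.Coprime d₀ q₀ then (1 : ℝ) else 0)| ≤ 1 := by
      split_ifs <;> simp
    have hσlog : 0 < (σ / 2) * Real.log x := by positivity
    have hpowpos : 0 < ((σ / 2) * Real.log x) ^ (8 : ℝ) := Real.rpow_pos_of_pos hσlog _
    -- the window sum
    have hwin : |∑ d₁ ∈ Finset.Icc 1 B₁,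
        (if (x : ℝ) ^ (1 - η) < (d₀ : ℝ) * d₁ ∧ (d₀ : ℝ) * d₁ ≤ (x : ℝ) ^ (1 + θ) ∧
            (x : ℝ) ^ σ < (d₀ : ℝ) ∧ (x : ℝ) ^ σ < (d₁ : ℝ) then
          (if Nat.Coprime d₁ q₁ ∧ ((Nat.gcd d₀ d₁ : ℕ) : ℤ) ∣ Δ then
              (μ d₁ : ℝ) * (α d₀ + β d₀ * Real.log d₁ + γ d₀ * Real.log d₁ ^ 2) *
                ((Nat.gcd d₀ d₁ : ℝ) / d₁) else 0) else 0)| ≤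
        K * (2 + 2 * Real.log x) * (4 : ℝ) ^ d₀.primeFactors.card /
          ((σ / 2) * Real.log x) ^ (8 : ℝ) := by
      by_cases hσd₀ : (x : ℝ) ^ σ < d₀
      · rw [← Finset.sum_filter, LinearPairMoebius.filter_window_eq hxσ hx1θ hσd₀]
        set A : ℝ := max ((x : ℝ) ^ σ) ((x : ℝ) ^ (1 - η) / d₀) with hAdef
        set b : ℕ := min ⌊(x : ℝ) ^ (1 + θ) / d₀⌋₊ B₁ with hbdef
        have hA : 2 * (Δ.natAbs : ℝ) ≤ A := hx₁.trans (le_max_left _ _)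
        rcases Nat.eq_zero_or_pos b with hb0 | hbpos
        · rw [hb0, Finset.Ioc_eq_empty (by omega), Finset.sum_empty, abs_zero]
          positivity
        have hb1 : 1 ≤ b := hbpos
        have h := abs_inner_le_quad hq₁ hΔ hC₀0 hC₁0 hC₂0 hC₀ hC₁ hC₂ (hα d₀ hd₀.1 hd₀.2)
          (hβ d₀ hd₀.1 hd₀.2) (hγ d₀ hd₀.1 hd₀.2) hd₀pos hA hb1
        refine h.trans ?_
        -- compare the logarithms: `log(A/D) ≥ (σ/2) log x`, `2 + log b ≤ 2 + 2 log x`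
        have hlogAD : (σ / 2) * Real.log x ≤ Real.log (A / Δ.natAbs) := by
          have hAσ : (x : ℝ) ^ σ / D ≤ A / D :=
            div_le_div_of_nonneg_right (le_max_left _ _) hDpos.le
          have hpos : 0 < (x : ℝ) ^ σ / D := by
            have : (0 : ℝ) < (x : ℝ) ^ σ := Real.rpow_pos_of_pos hx0 σ
            positivity
          calc (σ / 2) * Real.log x = Real.log ((x : ℝ) ^ σ) - Real.log ((x : ℝ) ^ (σ / 2)) := by
                rw [Real.log_rpow hx0, Real.log_rpow hx0]; ring
            _ ≤ Real.log ((x : ℝ) ^ σ) - Real.log D := by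
                have := Real.log_le_log hDpos hx₂; linarith
            _ = Real.log ((x : ℝ) ^ σ / D) := by
                rw [Real.log_div (Real.rpow_pos_of_pos hx0 σ).ne' hDpos.ne']
            _ ≤ Real.log (A / Δ.natAbs) := Real.log_le_log hpos hAσ
        have hpow : ((σ / 2) * Real.log x) ^ (8 : ℝ) ≤ Real.log (A / Δ.natAbs) ^ (8 : ℝ) :=
          Real.rpow_le_rpow hσlog.le hlogAD (by norm_num)
        have hbB : (b : ℝ) ≤ B₁ := by exact_mod_cast min_le_right _ _
        have hlogb : Real.log b ≤ 2 * Real.log x :=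
          (Real.log_le_log (by exact_mod_cast hbpos) hbB).trans hlogB1
        have hlogb2 : 2 + Real.log b ≤ 2 + 2 * Real.log x := by linarith
        rw [hKdef]
        rw [div_le_div_iff₀ (lt_of_lt_of_le hpowpos hpow) hpowpos]
        have hnum : 0 ≤ (Δ.natAbs.divisors.card : ℝ) * (1 + Real.log Δ.natAbs) ^ 2 *
            (C₀ + C₁ + C₂) * Λ * (4 : ℝ) ^ q₁.primeFactors.card *
              (4 : ℝ) ^ d₀.primeFactors.card := by positivity
        calc (Δ.natAbs.divisors.card : ℝ) * (1 + Real.log Δ.natAbs) ^ 2 * (C₀ + C₁ + C₂) * Λ *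
              (2 + Real.log b) * (4 : ℝ) ^ q₁.primeFactors.card *
              (4 : ℝ) ^ d₀.primeFactors.card * ((σ / 2) * Real.log x) ^ (8 : ℝ)
            = ((Δ.natAbs.divisors.card : ℝ) * (1 + Real.log Δ.natAbs) ^ 2 * (C₀ + C₁ + C₂) *
                Λ * (4 : ℝ) ^ q₁.primeFactors.card * (4 : ℝ) ^ d₀.primeFactors.card) *
              ((2 + Real.log b) * ((σ / 2) * Real.log x) ^ (8 : ℝ)) := by ring
          _ ≤ ((Δ.natAbs.divisors.card : ℝ) * (1 + Real.log Δ.natAbs) ^ 2 * (C₀ + C₁ + C₂) *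
                Λ * (4 : ℝ) ^ q₁.primeFactors.card * (4 : ℝ) ^ d₀.primeFactors.card) *
              ((2 + 2 * Real.log x) * Real.log (A / Δ.natAbs) ^ (8 : ℝ)) := by
              refine mul_le_mul_of_nonneg_left ?_ hnum
              exact mul_le_mul hlogb2 hpow hpowpos.le (by positivity)
          _ = _ := by ring
      · have hzero : ∑ d₁ ∈ Finset.Icc 1 B₁,
            (if (x : ℝ) ^ (1 - η) < (d₀ : ℝ) * d₁ ∧ (d₀ : ℝ) * d₁ ≤ (x : ℝ) ^ (1 + θ) ∧
              (x : ℝ) ^ σ < (d₀ : ℝ) ∧ (x : ℝ) ^ σ < (d₁ : ℝ) then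
            (if Nat.Coprime d₁ q₁ ∧ ((Nat.gcd d₀ d₁ : ℕ) : ℤ) ∣ Δ then
              (μ d₁ : ℝ) * (α d₀ + β d₀ * Real.log d₁ + γ d₀ * Real.log d₁ ^ 2) *
                ((Nat.gcd d₀ d₁ : ℝ) / d₁) else 0) else 0) = 0 := by
          refine Finset.sum_eq_zero fun d₁ _ => ?_
          rw [if_neg]
          rintro ⟨-, -, h, -⟩
          exact hσd₀ h
        rw [hzero, abs_zero]
        positivity
    have hG₀d : 0 ≤ G₀ / d₀ := div_nonneg hG₀ hd₀R.le
    calc |u₀ d₀ / d₀| * (|(if Nat.Coprime d₀ q₀ then (1 : ℝ) else 0)| * |_|)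
        ≤ (G₀ / d₀) * (1 * (K * (2 + 2 * Real.log x) * (4 : ℝ) ^ d₀.primeFactors.card /
            ((σ / 2) * Real.log x) ^ (8 : ℝ))) := by
          refine mul_le_mul hw (mul_le_mul hind hwin (abs_nonneg _) zero_le_one)
            (by positivity) hG₀d
      _ = _ := by ring
  -- Step 3: sum over `d₀`
  refine (Finset.abs_sum_le_sum_abs _ _).trans ?_
  refine (Finset.sum_le_sum hinner).trans ?_
  have hσlog : 0 < (σ / 2) * Real.log x := by positivity
  have hpowpos : 0 < ((σ / 2) * Real.log x) ^ (8 : ℝ) := Real.rpow_pos_of_pos hσlog _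
  have hrw : ∑ d₀ ∈ Finset.Icc 1 B₀, G₀ / d₀ *
      (K * (2 + 2 * Real.log x) * (4 : ℝ) ^ d₀.primeFactors.card /
        ((σ / 2) * Real.log x) ^ (8 : ℝ)) =
      G₀ * K * (2 + 2 * Real.log x) / ((σ / 2) * Real.log x) ^ (8 : ℝ) *
        ∑ d₀ ∈ Finset.Icc 1 B₀, (4 : ℝ) ^ d₀.primeFactors.card / d₀ := by
    rw [Finset.mul_sum]
    refine Finset.sum_congr rfl fun d₀ _ => ?_
    ring
  rw [hrw]
  have hlogB : Real.log B₀ ≤ 2 * Real.log x := by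
    rcases Nat.eq_zero_or_pos B₀ with h0 | hpos
    · rw [h0, Nat.cast_zero, Real.log_zero]; positivity
    · rw [← hlogx2]; exact Real.log_le_log (by exact_mod_cast hpos) hB0
  have hsum4 := MoebiusCoprimeTail.sum_four_pow_card_primeFactors_div_le B₀
  have hsum4' : ∑ d₀ ∈ Finset.Icc 1 B₀, (4 : ℝ) ^ d₀.primeFactors.card / d₀ ≤
      (3 * Real.log x) ^ 4 := by
    refine hsum4.trans ?_
    have hlogB0 : 0 ≤ Real.log B₀ := by
      rcases Nat.eq_zero_or_pos B₀ with h0 | hpos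
      · rw [h0, Nat.cast_zero, Real.log_zero]
      · exact Real.log_nonneg (by exact_mod_cast hpos)
    have : 1 + Real.log B₀ ≤ 3 * Real.log x := by linarith
    exact pow_le_pow_left₀ (by linarith) this 4
  have hsum0 : 0 ≤ ∑ d₀ ∈ Finset.Icc 1 B₀, (4 : ℝ) ^ d₀.primeFactors.card / d₀ :=
    Finset.sum_nonneg fun _ _ => by positivity
  -- `(σ/2 · log x)^8 = (σ/2)^8 (log x)^8`
  have hpow8 : ((σ / 2) * Real.log x) ^ (8 : ℝ) = (σ / 2) ^ (8 : ℝ) * Real.log x ^ 8 := by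
    rw [Real.mul_rpow (by positivity) (by positivity)]
    congr 1
    rw [show (8 : ℝ) = ((8 : ℕ) : ℝ) by norm_num, Real.rpow_natCast]
  have hσ8 : 0 < (σ / 2) ^ (8 : ℝ) := Real.rpow_pos_of_pos (by positivity) _
  have hinv : (2 / σ) ^ (8 : ℝ) = ((σ / 2) ^ (8 : ℝ))⁻¹ := by
    rw [← Real.inv_rpow (by positivity)]
    congr 1
    rw [inv_div]
  have hl : Real.log x ≠ 0 := by positivity
  have hfac0 : 0 ≤ G₀ * K * (2 + 2 * Real.log x) / ((σ / 2) * Real.log x) ^ (8 : ℝ) := by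
    positivity
  calc G₀ * K * (2 + 2 * Real.log x) / ((σ / 2) * Real.log x) ^ (8 : ℝ) *
        ∑ d₀ ∈ Finset.Icc 1 B₀, (4 : ℝ) ^ d₀.primeFactors.card / d₀
      ≤ G₀ * K * (2 + 2 * Real.log x) / ((σ / 2) * Real.log x) ^ (8 : ℝ) *
          (3 * Real.log x) ^ 4 := mul_le_mul_of_nonneg_left hsum4' hfac0
    _ = G₀ * K * (2 + 2 * Real.log x) * 3 ^ 4 * ((σ / 2) ^ (8 : ℝ))⁻¹ / Real.log x ^ 4 := by
        rw [hpow8]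
        field_simp
    _ = _ := by rw [hinv]

end Summit.Parity.BatemanHorn.Theorems.PairWindow
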